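import Mathlib
import Summits.Ventures.PercRepro2.Defs
import Summits.Ventures.PercRepro2.Harris
import Summits.Ventures.PercRepro2.Graph
import Summits.Ventures.PercRepro2.Events
import Summits.Ventures.PercRepro2.Induced
import Summits.Ventures.PercRepro2.CDAvoidAnti
import Summits.Ventures.PercRepro2.XorHalf

/-!
# (T_h) implies (XOR) for a single avoided point (blind cell PercRepro2, mine-a g40;
MINE-A.md §95.6 (a))

The cell's (XOR) for `X = {h}` (XorHalf.lean, proved there for `P(R) ≤ 1/2`) and the three-event
inequality (T_h) (TFKG.lean, kernel on forests and cacti; the lane's candidate of record in general)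
are two members of one linear family (MINE-A.md §95.6 (a)): with `R = {s ↮ h}`, `Q = Rᶜ = {h ∈ C_s}`
and the seven masses `a = P(RUe)`, `a′ = P(RᶜUe)`, `b = P(RU)`, `b′ = P(RᶜU)`, `d = P(Re)`,
`d′ = P(Rᶜe)`, `π = P(R)`, `π′ = P(Rᶜ)`,

  `XOR = a π′ + a′ π − b d′ − b′ d`,   `T = (1 + π′) a′ + π′ a − 2 b′ d′ − b′ d − b d′`,

and EXACTLY `XOR = T − 2 (a′ π′ − b′ d′)` (`xor_eq_t_sub`) and
`π π′ · XOR = π′² (a π − b d) + π² (a′ π′ − b′ d′) + (b′ π − b π′)(d′ π − d π′)` (`pi_mul_xor_eq`).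
Hence (`xorForm_nonneg_of_t`): if (T_h) holds then (XOR) holds for `X = {h}` — when the hitting
world is negatively correlated (`a′ π′ < b′ d′`) directly from `XOR ≥ T`, and otherwise from the
second identity, whose three terms are BHK under `R` (`CDAvoidAnti.bhk_same_cluster_avoid`), the
hitting-world covariance, and the product of two Harris covariances `Cov(Rᶜ, U)`, `Cov(Rᶜ, e)`.
No definition; one seat.
-/

namespace Summit.Ventures.PercRepro2

namespace TImpliesXor

variable {V : Type*} {E : Type*} [Fintype V] [DecidableEq V] [Fintype E] [DecidableEq E]
  {R : Type*} [Field R] [LinearOrder R] [IsStrictOrderedRing R]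

omit [Fintype V] [DecidableEq V] [Fintype E] [DecidableEq E] [LinearOrder R] [IsStrictOrderedRing R] in
/-- `XOR = T − 2 (a′ π′ − b′ d′)`, as polynomials in the seven masses (`π′ = 1 − π`). -/
lemma xor_eq_t_sub (a a' b b' d d' π : R) :
    a * (1 - π) + a' * π - b * d' - b' * d =
      ((1 + (1 - π)) * a' + (1 - π) * a - 2 * b' * d' - b' * d - b * d')
        - 2 * (a' * (1 - π) - b' * d') := by ring

omit [Fintype V] [DecidableEq V] [Fintype E] [DecidableEq E] [LinearOrder R] [IsStrictOrderedRing R] in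
/-- `π π′ · XOR = π′² (a π − b d) + π² (a′ π′ − b′ d′) + (b′ π − b π′)(d′ π − d π′)`. -/
lemma pi_mul_xor_eq (a a' b b' d d' π : R) :
    π * (1 - π) * (a * (1 - π) + a' * π - b * d' - b' * d) =
      (1 - π) ^ 2 * (a * π - b * d) + π ^ 2 * (a' * (1 - π) - b' * d')
        + (b' * π - b * (1 - π)) * (d' * π - d * (1 - π)) := by ring

/-- **(T_h) ⟹ (XOR) for `X = {h}`**: for admissible weights, a root `s`, a vertex `h` and up-sets
`𝓤, 𝓥`, if `P(Q ∩ U)·P(e) + P(U)·P(Q ∩ e) ≤ P(Q ∩ U ∩ e) + P(Q)·P(U ∩ e)` with `Q = {h ∈ C_s}`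
(the conclusion of `TFKG.t_of_isForest` etc.), then the XOR form of XorHalf with `R = {s ↮ h}` is
nonnegative. -/
theorem xorForm_nonneg_of_t (p : E → R) (hp : IsProbVec p) (ends : E → Sym2 V) (s h : V)
    {𝓤 𝓥 : Set (Set V)} (h𝓤 : IsUpperSet 𝓤) (h𝓥 : IsUpperSet 𝓥)
    (ht : let Q := clusterInEvent ends s {T : Set V | h ∈ T}
      let U := clusterInEvent ends s 𝓤
      let e := clusterInEvent ends s 𝓥
      prob p (Q ∩ U) * prob p e + prob p U * prob p (Q ∩ e) ≤
        prob p (Q ∩ U ∩ e) + prob p Q * prob p (U ∩ e)) :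
    let Rv := avoidAll ends s {h}
    let U := clusterInEvent ends s 𝓤
    let e := clusterInEvent ends s 𝓥
    0 ≤ prob p (Rv ∩ U ∩ e) * prob p Rvᶜ + prob p (Rvᶜ ∩ U ∩ e) * prob p Rv -
        prob p (Rv ∩ U) * prob p (Rvᶜ ∩ e) - prob p (Rvᶜ ∩ U) * prob p (Rv ∩ e) := by
  intro Rv U e
  simp only at ht
  -- `Q = Rvᶜ`
  have hQ : clusterInEvent ends s {T : Set V | h ∈ T} = Rvᶜ := by
    ext ω
    simp only [clusterInEvent, cluster, Set.mem_setOf_eq, Rv, avoidAll, Set.mem_compl_iff,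
      Finset.mem_singleton, forall_eq, not_not]
  rw [hQ] at ht
  have hRlow : IsLowerSet Rv := XorHalf.isLowerSet_avoidAll ends s {h}
  have hUup : IsUpperSet U := isUpperSet_clusterInEvent ends s h𝓤
  have heup : IsUpperSet e := isUpperSet_clusterInEvent ends s h𝓥
  -- the seven masses
  set a := prob p (Rv ∩ U ∩ e) with ha
  set a' := prob p (Rvᶜ ∩ U ∩ e) with ha'
  set b := prob p (Rv ∩ U) with hb
  set b' := prob p (Rvᶜ ∩ U) with hb'
  set d := prob p (Rv ∩ e) with hd
  set d' := prob p (Rvᶜ ∩ e) with hd'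
  set π := prob p Rv with hπ
  have hπ' : prob p Rvᶜ = 1 - π := prob_compl p Rv
  have hPU : prob p U = b + b' := by
    rw [hb, hb', ← prob_inter_add_prob_inter_compl p U Rv, Set.inter_comm U Rv, Set.inter_comm U Rvᶜ]
  have hPe : prob p e = d + d' := by
    rw [hd, hd', ← prob_inter_add_prob_inter_compl p e Rv, Set.inter_comm e Rv, Set.inter_comm e Rvᶜ]
  have hPUe : prob p (U ∩ e) = a + a' := by
    rw [ha, ha', ← prob_inter_add_prob_inter_compl p (U ∩ e) Rv, Set.inter_comm (U ∩ e) Rv,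
      Set.inter_comm (U ∩ e) Rvᶜ, ← Set.inter_assoc, ← Set.inter_assoc]
  rw [hπ', hPU, hPe, hPUe] at ht
  -- (T) in the seven masses
  have hT : b' * (d + d') + (b + b') * d' ≤ a' + (1 - π) * (a + a') := ht
  -- BHK under `R`: `b d ≤ π a`
  have hbhk : b * d ≤ π * a := by
    have := CDAvoidAnti.bhk_same_cluster_avoid p ends hp s {h} h𝓤 h𝓥
    have e1 : U ∩ Rv = Rv ∩ U := Set.inter_comm _ _
    have e2 : e ∩ Rv = Rv ∩ e := Set.inter_comm _ _
    have e3 : U ∩ e ∩ Rv = Rv ∩ U ∩ e := by ext ω; simp only [Set.mem_inter_iff]; tauto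
    rw [e1, e2, e3] at this
    linarith
  -- Harris: `Cov(Rᶜ, U) ≥ 0` and `Cov(Rᶜ, e) ≥ 0`, i.e. `b π′ ≤ b′ π` and `d π′ ≤ d′ π`
  have hRcup : IsUpperSet Rvᶜ := hRlow.compl
  have hcovU : prob p Rvᶜ * prob p U ≤ prob p (Rvᶜ ∩ U) := prob_mul_prob_le_prob_inter hp hRcup hUup
  have hcove : prob p Rvᶜ * prob p e ≤ prob p (Rvᶜ ∩ e) := prob_mul_prob_le_prob_inter hp hRcup heup
  rw [hπ', hPU] at hcovU
  rw [hπ', hPe] at hcove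
  have hU' : b * (1 - π) ≤ b' * π := by nlinarith [hcovU]
  have he' : d * (1 - π) ≤ d' * π := by nlinarith [hcove]
  -- nonnegativity and the trivial bounds
  have ha0 : 0 ≤ a := prob_nonneg hp _
  have ha'0 : 0 ≤ a' := prob_nonneg hp _
  have hb0 : 0 ≤ b := prob_nonneg hp _
  have hb'0 : 0 ≤ b' := prob_nonneg hp _
  have hd0 : 0 ≤ d := prob_nonneg hp _
  have hd'0 : 0 ≤ d' := prob_nonneg hp _
  have hπ0 : 0 ≤ π := prob_nonneg hp _
  have hπ1 : π ≤ 1 := prob_le_one hp _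
  have haπ : a ≤ π := by
    have := prob_inter_le_left hp (Rv ∩ U) e
    have := prob_inter_le_left hp Rv U
    linarith
  have hbπ : b ≤ π := prob_inter_le_left hp Rv U
  have hdπ : d ≤ π := prob_inter_le_left hp Rv e
  have hπ'0 : 0 ≤ 1 - π := sub_nonneg.2 hπ1
  have ha'π : a' ≤ 1 - π := by
    have h1 := prob_inter_le_left hp (Rvᶜ ∩ U) e
    have h2 := prob_inter_le_left hp Rvᶜ U
    rw [hπ'] at h2
    linarith
  have hb'π : b' ≤ 1 - π := by have := prob_inter_le_left hp Rvᶜ U; rwa [hπ'] at this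
  have hd'π : d' ≤ 1 - π := by have := prob_inter_le_left hp Rvᶜ e; rwa [hπ'] at this
  -- the two identities
  have hid1 := xor_eq_t_sub (R := R) a a' b b' d d' π
  have hid2 := pi_mul_xor_eq (R := R) a a' b b' d d' π
  rw [hπ']
  -- the goal in the masses
  show 0 ≤ a * (1 - π) + a' * π - b * d' - b' * d
  rcases le_or_gt (a' * (1 - π)) (b' * d') with hneg | hpos
  · -- the hitting world is negatively correlated: `XOR ≥ T ≥ 0`
    rw [hid1]; linarith
  · -- otherwise all three terms of the second identity are nonnegative
    have h3 : 0 ≤ (b' * π - b * (1 - π)) * (d' * π - d * (1 - π)) :=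
      mul_nonneg (by linarith) (by linarith)
    have hsum : 0 ≤ π * (1 - π) * (a * (1 - π) + a' * π - b * d' - b' * d) := by
      rw [hid2]
      have := mul_nonneg (sq_nonneg (1 - π)) (sub_nonneg.2 hbhk)
      have := mul_nonneg (sq_nonneg π) (sub_nonneg.2 hpos.le)
      linarith
    rcases hπ0.lt_or_eq with hπpos | hπzero
    · rcases hπ'0.lt_or_eq with hπ'pos | hπ'zero
      · have hprod : 0 < π * (1 - π) := mul_pos hπpos hπ'pos
        exact le_of_mul_le_mul_left (by simpa using hsum) hprod
      · -- `π = 1`: the hitting world is empty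
        have ha' : a' = 0 := le_antisymm (by linarith) ha'0
        have hb' : b' = 0 := le_antisymm (by linarith) hb'0
        have hd' : d' = 0 := le_antisymm (by linarith) hd'0
        rw [ha', hb', hd', ← hπ'zero]; ring_nf; exact le_refl 0
    · -- `π = 0`: the avoiding world is empty
      have haz : a = 0 := le_antisymm (by linarith) ha0
      have hbz : b = 0 := le_antisymm (by linarith) hb0
      have hdz : d = 0 := le_antisymm (by linarith) hd0
      rw [haz, hbz, hdz, ← hπzero]; ring_nf; exact le_refl 0

end TImpliesXor

end Summit.Ventures.PercRepro2
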